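/-
Copyright: see repository licence. Literature formalisation — Fitzner–van der Hofstad, *Mean-field behavior for
nearest-neighbor percolation in `d > 10`*, EJP 22 (2017) no. 43 (extended version arXiv:1506.07977v2), App. C.1
Case b) (`w = 0`, `u ≠ w`), "Bound in (C.3)" (p. 79): the two `w = 0` rows `a = 1, 2` of the remainder `R_R(ι,a)` of
`Ξ^{(1)}_R`, the middle block priced by `sup_{x≠0} H₂(x)`.
-/
import Literature.Probability.FitznerVanDerHofstad2017.NobleWeightedLettersHn
import Literature.Probability.FitznerVanDerHofstad2017.NobleWeightedN1Assembly
import Literature.Probability.FitznerVanDerHofstad2017.NobleBlocksPrime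
import Literature.Probability.FitznerVanDerHofstad2017.UnitVectorPairSums
import HarnessLib

/-!
# The two `w = 0` rows of `R_R(ι,a)`, `a = 1, 2`: middle block `Ā^{ι,a,0}(u,0,x,x)` priced by `sup_{x ≠ 0} H₂(x)`

[FvdH17, App. C.1, Case b) (`w = 0`, `u ≠ w`) and the bound (C.3)] (arXiv:1506.07977v2 p. 79; TeX `AdditionalBoundFile`
"Bound in (C.3)"): in the remainder term of `Ξ^{(1)}_R` with `w = 0` and trivial exit (`t = z = x`) the middle block
is the App. B row `b = 0` of the double-open triangle, `Ā^{ι,a,0}(u,0,x,x) = A^{ι,a,0}(u,0,x,x)`, i.e. (base point `u`)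
the repulsive triangle `𝓣_{1̲,1,0}(e_ι, x−u, −u)`; by translation invariance, relabelling of the lines and
`{x ↔ 0} = {x ←1→ 0}` for `x ≠ 0` this is the print letter `𝓣_{1,1,1̲}(x, u+e_ι, u)` of the second member of
`H₂(u)` ((Hi-defs), §5.2 p. 50), so that
`Σ_{ι,x} ‖x‖₂² Ā^{ι,2,0}(u,0,x,x) = Σ_{e,y} ‖y‖₂² 𝓣_{1,1,1̲}(y,u−e,u) ≤ H₂(u) ≤ sup_{x≠0} H₂(x)` (`u ≠ 0`), and the
row `a = 1` carries the extra factors `(1−δ_{x,u}) 2dD(−u) ≤ 1`.  Summing the start letter over `u` gives the two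
rows (the start bracket is kept as the two App. B letters `P^{S,1}(u,0) = (1−δ_{0,u}) 𝓑_{3,1̲}(u,0)` and
`P^{S,2}(u,0) = (1−δ_{0,u}) 𝓓_{2,2}(u)`, coefficient `1` each; the print merges them into `ℙ(0 ⇔ u)`):

* `Σ_ι R_R^{w=0}(ι,1) ≤ sup_{x≠0} H₂(x) · Σ_{u≠0} 𝓑_{3,1̲}(u,0)`  (`sum_rawRPieceAt0_one_le`),
* `Σ_ι R_R^{w=0}(ι,2) ≤ sup_{x≠0} H₂(x) · Σ_{u≠0} 𝓓_{2,2}(u)`    (`sum_rawRPieceAt0_two_le`),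

where `R_R^{w=0}(ι,a) = rawRPieceAt0 (P^S − trivial) Ā' ι a = Σ_{x,u} ‖x‖₂² P^{S,a}_n(u,0) Ā'^{ι,a,0}(u,0,x,x)`
(`NobleWeightedN1Assembly.rawRPieceAt0`).  Sections: A. the table rows `(a,0)` of `Ā'` at `(u,0,x,x)` (general letter
table `L`); B. the transport to the print letter and the identification with `letterHT₁ 𝐋 2 u` (percolation);
C. the `u`-summation against a start letter vanishing at `u = 0` (general `L`); D. the two rows.
Print does not split Case b) by the start class `a`; Cases c), d) of App. C.1 ((C.4), (C.5), pp. 79–80) are the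
`w ≠ 0` cases (the locus of DIVERGENCE D98 ∕ GAPS G-D98 of the packet), not part of this module.
No numeral is attached here (the numerals of record for these rows are the certificate's, not this module's).
-/

namespace Literature.Probability.FitznerVanDerHofstad2017.NobleBlocks

open _root_.MeasureTheory Literature.Probability.LatticeModels Literature.Probability.Percolation
open Literature.Probability.FitznerVanDerHofstad2017.NobleBlocks.LenIdx
open Literature.Probability.FitznerVanDerHofstad2017.UnitVectorPairs (opp opp_opp)
open scoped BigOperators ENNReal

variable {d : ℕ}

local notation "𝐞" => Literature.Probability.Percolation.stepVec

/-! ### A. The rows `(a,0)`, `a = 1, 2`, of `Ā'^{ι,a,b}` at a trivial exit `(u,0,x,x)` -/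

section Table

variable (L : Letters d) (ι : Fin d × Bool)

/-- `Ā'^{ι,2,0}(u,w,t,z) = Ā^{ι,2,0}(u,w,t,z) = A^{ι,2,0}(u,w,t,z) = δ_{t,z} 𝓣_{1̲,1,0}(e_ι, t−u, w−u)` (base point `u`).
[cite: FitznerVanDerHofstad2017, App. B Table "definition of A^{ι,a,b}", row a = 2, b = 0 (arXiv:1506.07977v2 p. 75); App. B display "double-open triangle Ā^{ι,a,b}", first line (p. 78)] -/
theorem blockAbar'_two_zero_apply (u w t z : Site d) :
    blockAbar' L ι 2 0 u w t z = kd (t - u) (z - u) * L.T (.eq 1) (.ge 1) (.ge 0) (𝐞 ι) (t - u) (w - u) := by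
  rw [blockAbar'_of_ne L ι (by decide)]
  rfl

/-- `Ā'^{ι,1,0}(u,w,t,z) = δ_{t,z} (1−δ_{t,u}) 2dD(w−u) 𝓣_{1̲,1,0}(e_ι, t−u, w−u)` (base point `u`).
[cite: FitznerVanDerHofstad2017, App. B Table "definition of A^{ι,a,b}", row a = 1, b = 0 (arXiv:1506.07977v2 p. 75); App. B display "double-open triangle Ā^{ι,a,b}", first line (p. 78)] -/
theorem blockAbar'_one_zero_apply (u w t z : Site d) :
    blockAbar' L ι 1 0 u w t z =
      kd (t - u) (z - u) * kdc (t - u) 0 * twoDD (w - u) * L.T (.eq 1) (.ge 1) (.ge 0) (𝐞 ι) (t - u) (w - u) := by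
  rw [blockAbar'_of_ne L ι (by decide)]
  rfl

/-- At a trivial exit with `w = 0`: `Ā'^{ι,2,0}(u,0,x,x) = 𝓣_{1̲,1,0}(e_ι, x−u, −u)`.
[cite: FitznerVanDerHofstad2017, App. C.1 Case b) (w = 0, u ≠ w), bound (C.3) (arXiv:1506.07977v2 p. 79); App. B Table row a = 2, b = 0 (p. 75)] -/
theorem blockAbar'_two_zero_exit (u x : Site d) :
    blockAbar' L ι 2 0 u 0 x x = L.T (.eq 1) (.ge 1) (.ge 0) (𝐞 ι) (x - u) (-u) := by
  rw [blockAbar'_two_zero_apply, kd_self, one_mul, zero_sub]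

/-- At a trivial exit with `w = 0`: `Ā'^{ι,1,0}(u,0,x,x) ≤ 𝓣_{1̲,1,0}(e_ι, x−u, −u)` (`(1−δ)·2dD ≤ 1`).
[cite: FitznerVanDerHofstad2017, App. C.1 Case b) (w = 0, u ≠ w), bound (C.3) (arXiv:1506.07977v2 p. 79); App. B Table row a = 1, b = 0 (p. 75)] -/
theorem blockAbar'_one_zero_exit_le (u x : Site d) :
    blockAbar' L ι 1 0 u 0 x x ≤ L.T (.eq 1) (.ge 1) (.ge 0) (𝐞 ι) (x - u) (-u) := by
  rw [blockAbar'_one_zero_apply, kd_self, one_mul, zero_sub]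
  calc kdc (x - u) 0 * twoDD (-u) * L.T (.eq 1) (.ge 1) (.ge 0) (𝐞 ι) (x - u) (-u)
      ≤ 1 * 1 * L.T (.eq 1) (.ge 1) (.ge 0) (𝐞 ι) (x - u) (-u) := by
        gcongr
        · exact kdc_le_one _ _
        · exact twoDD_le_one _
    _ = _ := by rw [one_mul, one_mul]

end Table

/-! ### B. Percolation: the middle letter is the print letter `𝓣_{1,1,1̲}(x, u+e_ι, u)` of `H₂(u)` -/

section Transport

variable (p : unitInterval)

/-- `e_{opp ι} = −e_ι`. [folklore] -/
private theorem stepVec_opp' (ι : Fin d × Bool) : (𝐞 (opp ι) : Site d) = -𝐞 ι := by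
  obtain ⟨i, b⟩ := ι
  cases b <;> simp [Percolation.stepVec, opp]

/-- **Transport of the middle letter** (`x ≠ 0`): `𝓣_{1̲,1,0}(e_ι, x−u, −u)` (base point `u`: lines
`{u ←1̲→ u+e_ι}, {u+e_ι ←1→ x}, {x ←0→ 0}`) `= 𝓣_{1,1,1̲}(x, u+e_ι, u)` (lines `{0 ←1→ x}, {x ←1→ u+e_ι},
{u+e_ι ←1̲→ u}`): translation by `u`, `{x ←0→ 0} = {x ←1→ 0}` for `x ≠ 0`, lines relabelled in reverse order and
read backwards. [cite: FitznerVanDerHofstad2017, §4.2 Def. 4.1, (4.1), (4.17) (arXiv:1506.07977v2 pp. 34–36); App. C.1 (C.3) (p. 79)] -/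
theorem perc_T_mid_transport {x : Site d} (hx : x ≠ 0) (u : Site d) (ι : Fin d × Bool) :
    (Letters.perc d p).T (.eq 1) (.ge 1) (.ge 0) (𝐞 ι) (x - u) (-u) =
      (Letters.perc d p).T (.ge 1) (.ge 1) (.eq 1) x (u + 𝐞 ι) u := by
  rw [perc_T, perc_T]
  have h1 : lineEvents₃ (.eq 1) (.ge 1) (.ge 0) (𝐞 ι) (x - u) (-u) =
      fun i => event ((![.eq 1, .ge 1, .ge 0] : Fin 3 → LenIdx) i) ((![0, 𝐞 ι, x - u] : Fin 3 → Site d) i)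
        ((![𝐞 ι, x - u, -u] : Fin 3 → Site d) i) := by
    funext i
    fin_cases i <;> rfl
  have hx0 : (event (.ge 0) x 0 : Set (BondConfig (Site d))) = event (.ge 1) x 0 := by
    rw [event_ge, event_ge, openConnGe_zero, openConnGe_one_eq hx]
  have h2 : (fun i => event ((![.eq 1, .ge 1, .ge 0] : Fin 3 → LenIdx) i) ((![0, 𝐞 ι, x - u] : Fin 3 → Site d) i + u)
        ((![𝐞 ι, x - u, -u] : Fin 3 → Site d) i + u)) =
      lineEvents₃ (.ge 1) (.ge 1) (.eq 1) x (u + 𝐞 ι) u ∘ ⇑(Fin.revPerm : Equiv.Perm (Fin 3)) := by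
    funext i
    fin_cases i
    · simp only [Fin.zero_eta, Fin.isValue, Matrix.cons_val_zero, zero_add, Function.comp_apply, lineEvents₃]
      rw [event_comm, add_comm]
      rfl
    · simp only [Fin.mk_one, Fin.isValue, Matrix.cons_val, sub_add_cancel, Function.comp_apply, lineEvents₃]
      rw [event_comm, add_comm]
      rfl
    · simp only [Fin.reduceFinMk, Fin.isValue, Matrix.cons_val, sub_add_cancel, neg_add_cancel,
        Function.comp_apply, lineEvents₃]
      rw [hx0, event_comm]
      rfl
  rw [h1, ← repLetter_event_shift p u, h2, repLetter_comp_perm]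

/-- Weighted form, all `x`: `Σ_x ‖x‖₂² 𝓣_{1̲,1,0}(e_ι,x−u,−u) = Σ_x ‖x‖₂² 𝓣_{1,1,1̲}(x,u+e_ι,u)` (the term `x = 0`
has weight `0`). [cite: FitznerVanDerHofstad2017, App. C.1 (C.3) (arXiv:1506.07977v2 p. 79); §5.2 (Hi-defs) (p. 50)] -/
theorem tsum_wt_mul_perc_T_mid (u : Site d) (ι : Fin d × Bool) :
    ∑' x, wt x * (Letters.perc d p).T (.eq 1) (.ge 1) (.ge 0) (𝐞 ι) (x - u) (-u) =
      ∑' x, wt x * (Letters.perc d p).T (.ge 1) (.ge 1) (.eq 1) x (u + 𝐞 ι) u := by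
  refine tsum_congr fun x => ?_
  by_cases hx : x = 0
  · subst hx; rw [wt_zero, zero_mul, zero_mul]
  · rw [perc_T_mid_transport p hx]

/-- Summed over the directions, the transported letter is the second member of `H₂(u)`:
`Σ_ι Σ_x ‖x‖₂² 𝓣_{1,1,1̲}(x,u+e_ι,u) = Σ_{e,y} ‖y‖₂² 𝓣_{1,1,1̲}(y,u−e,u)` (`e ↦ −e`).
[cite: FitznerVanDerHofstad2017, §5.2 (Hi-defs), second member, n = 2 (arXiv:1506.07977v2 p. 50)] -/
theorem sum_tsum_wt_mul_perc_T_eq_letterHT₁_two (u : Site d) :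
    ∑ ι, ∑' x, wt x * (Letters.perc d p).T (.ge 1) (.ge 1) (.eq 1) x (u + 𝐞 ι) u = letterHT₁ (Letters.perc d p) 2 u := by
  unfold letterHT₁
  refine Fintype.sum_equiv (Function.Involutive.toPerm opp opp_opp) _ _ fun ι => ?_
  simp only [Function.Involutive.coe_toPerm, stepVec_opp', sub_neg_eq_add]

/-- **The middle block of the row `a = 2` at `w = 0` (Case b)), summed**: `Σ_ι Σ_x ‖x‖₂² Ā'^{ι,2,0}(u,0,x,x) = (second member of H₂(u))`.
[cite: FitznerVanDerHofstad2017, App. C.1 Case b) (w = 0, u ≠ w), bound (C.3) (arXiv:1506.07977v2 p. 79); §5.2 (Hi-defs) (p. 50)] -/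
theorem sum_tsum_wt_mul_blockAbar'_two_zero_eq (u : Site d) :
    ∑ ι, ∑' x, wt x * blockAbar' (Letters.perc d p) ι 2 0 u 0 x x = letterHT₁ (Letters.perc d p) 2 u := by
  rw [← sum_tsum_wt_mul_perc_T_eq_letterHT₁_two]
  refine Finset.sum_congr rfl fun ι _ => ?_
  rw [← tsum_wt_mul_perc_T_mid]
  simp_rw [blockAbar'_two_zero_exit]

/-- **The middle block of the row `a = 1` at `w = 0` (Case b)), summed**: `Σ_ι Σ_x ‖x‖₂² Ā'^{ι,1,0}(u,0,x,x) ≤ (second member of H₂(u))`.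
[cite: FitznerVanDerHofstad2017, App. C.1 Case b) (w = 0, u ≠ w), bound (C.3) (arXiv:1506.07977v2 p. 79); §5.2 (Hi-defs) (p. 50)] -/
theorem sum_tsum_wt_mul_blockAbar'_one_zero_le (u : Site d) :
    ∑ ι, ∑' x, wt x * blockAbar' (Letters.perc d p) ι 1 0 u 0 x x ≤ letterHT₁ (Letters.perc d p) 2 u := by
  rw [← sum_tsum_wt_mul_blockAbar'_two_zero_eq]
  gcongr with ι _ x
  rw [blockAbar'_two_zero_exit]
  exact blockAbar'_one_zero_exit_le _ ι u x

/-- For `u ≠ 0`: `Σ_ι Σ_x ‖x‖₂² Ā'^{ι,a,0}(u,0,x,x) ≤ sup_{x≠0} H₂(x)`, `a = 2`.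
[cite: FitznerVanDerHofstad2017, App. C.1 (C.3) (arXiv:1506.07977v2 p. 79); §5.2, display after (HD-def) (p. 50)] -/
theorem sum_tsum_wt_mul_blockAbar'_two_zero_le_letterHsup {u : Site d} (hu : u ≠ 0) :
    ∑ ι, ∑' x, wt x * blockAbar' (Letters.perc d p) ι 2 0 u 0 x x ≤ letterHsup (Letters.perc d p) 2 := by
  rw [sum_tsum_wt_mul_blockAbar'_two_zero_eq]
  exact (letterHT₁_le_letterH _ 2 u).trans (letterH_le_letterHsup _ 2 hu)

/-- For `u ≠ 0`: `Σ_ι Σ_x ‖x‖₂² Ā'^{ι,a,0}(u,0,x,x) ≤ sup_{x≠0} H₂(x)`, `a = 1`.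
[cite: FitznerVanDerHofstad2017, App. C.1 (C.3) (arXiv:1506.07977v2 p. 79); §5.2, display after (HD-def) (p. 50)] -/
theorem sum_tsum_wt_mul_blockAbar'_one_zero_le_letterHsup {u : Site d} (hu : u ≠ 0) :
    ∑ ι, ∑' x, wt x * blockAbar' (Letters.perc d p) ι 1 0 u 0 x x ≤ letterHsup (Letters.perc d p) 2 :=
  (sum_tsum_wt_mul_blockAbar'_one_zero_le p u).trans
    ((letterHT₁_le_letterH _ 2 u).trans (letterH_le_letterHsup _ 2 hu))

end Transport

/-! ### C. Summing the start letter over `u` against a uniform bound on the middle block -/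

section Assembly

/-- **`u`-summation of a `w = 0` row**: if the start letter vanishes at `u = 0`, `Sₙ(a;u,0) = (1−δ_{u,0}) R(u)`, and the
summed weighted middle block is uniformly bounded, `Σ_ι Σ_x ‖x‖₂² Ā(ι,a,0;u,0,x,x) ≤ M` for `u ≠ 0`, then
`Σ_ι Σ_{x,u} ‖x‖₂² Sₙ(a;u,0) Ā(ι,a,0;u,0,x,x) ≤ M · Σ_u (1−δ_{u,0}) R(u)` (the sup-extraction of (C.3)).
[cite: FitznerVanDerHofstad2017, App. C.1, Bound in (C.3) (arXiv:1506.07977v2 p. 79)] -/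
theorem sum_rawRPieceAt0_le_of_mid (Sn : Fin 3 → Site d → Site d → ℝ≥0∞) (Ab : DirBlockFamily d) (a : Fin 3)
    (R : Site d → ℝ≥0∞) (M : ℝ≥0∞) (hSn : ∀ u, Sn a u 0 = kdc u 0 * R u)
    (hmid : ∀ u, u ≠ 0 → ∑ ι, ∑' x, wt x * Ab ι a 0 u 0 x x ≤ M) :
    ∑ ι, rawRPieceAt0 Sn Ab ι a ≤ M * ∑' u, kdc u 0 * R u := by
  have hsw : ∑ ι, rawRPieceAt0 Sn Ab ι a = ∑' u, Sn a u 0 * ∑ ι, ∑' x, wt x * Ab ι a 0 u 0 x x := by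
    unfold rawRPieceAt0
    simp_rw [fun ι => ENNReal.tsum_comm (f := fun x u => wt x * (Sn a u 0 * Ab ι a 0 u 0 x x))]
    rw [← BlockSummation.tsum_finsetSum]
    refine tsum_congr fun u => ?_
    rw [Finset.mul_sum]
    refine Finset.sum_congr rfl fun ι _ => ?_
    rw [← ENNReal.tsum_mul_left]
    refine tsum_congr fun x => ?_
    ring
  rw [hsw, mul_comm, ← ENNReal.tsum_mul_right]
  refine ENNReal.tsum_le_tsum fun u => ?_
  by_cases hu : u = 0
  · subst hu; rw [hSn, kdc_self, zero_mul, zero_mul, zero_mul]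
  · rw [hSn]
    exact mul_le_mul' le_rfl (hmid u hu)

end Assembly

/-! ### D. The two rows -/

section Rows

/-- `P^{S,1}_n(u,0) = P^{S,1}(u,0) = (1−δ_{u,0}) 𝓑_{3,1̲}(u,0)`.
[cite: FitznerVanDerHofstad2017, App. B Table "Repulsive triangles P^{S,b}", row b = 1 at y = 0 (arXiv:1506.07977v2 p. 73)] -/
theorem blockPSn_one_zero_right (L : Letters d) (u : Site d) : blockPSn L 1 u 0 = kdc u 0 * L.B (.ge 3) (.eq 1) u 0 := by
  rw [blockPSn_of_ne_zero L (by decide)]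
  show kdc u 0 * (kd (0 : Site d) 0 * L.B (.ge 3) (.eq 1) u 0 + kdc (0 : Site d) 0 * L.T (.ge 1) (.eq 1) (.ge 1) u 0 0) = _
  rw [kd_self, kdc_self, one_mul, zero_mul, add_zero]

/-- `P^{S,2}_n(u,0) = P^{S,2}(u,0) = (1−δ_{u,0}) 𝓓_{2,2}(u)`.
[cite: FitznerVanDerHofstad2017, App. B Table "Repulsive triangles P^{S,b}", row b = 2 at y = 0 (arXiv:1506.07977v2 p. 73)] -/
theorem blockPSn_two_zero_right (L : Letters d) (u : Site d) : blockPSn L 2 u 0 = kdc u 0 * L.D (.ge 2) (.ge 2) u := by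
  rw [blockPSn_of_ne_zero L (by decide)]
  show kdc u 0 * (kd (0 : Site d) 0 * L.D (.ge 2) (.ge 2) u + kdc (0 : Site d) 0 * L.T (.ge 1) (.ge 2) (.ge 1) u 0 0) = _
  rw [kd_self, kdc_self, one_mul, zero_mul, add_zero]

variable (p : unitInterval)

/-- **Row `a = 1`, `w = 0` of `R_R`** (Case b)): `Σ_ι R_R^{w=0}(ι,1) ≤ sup_{x≠0} H₂(x) · Σ_{u≠0} 𝓑_{3,1̲}(u,0)`.
[cite: FitznerVanDerHofstad2017, App. C.1 Case b) (w = 0, u ≠ w), bound (C.3) (arXiv:1506.07977v2 p. 79)] -/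
theorem sum_rawRPieceAt0_one_le :
    ∑ ι, rawRPieceAt0 (blockPSn (Letters.perc d p)) (blockAbar' (Letters.perc d p)) ι 1 ≤
      letterHsup (Letters.perc d p) 2 * ∑' u, kdc u 0 * (Letters.perc d p).B (.ge 3) (.eq 1) u 0 :=
  sum_rawRPieceAt0_le_of_mid _ _ 1 _ _ (blockPSn_one_zero_right _)
    fun _ hu => sum_tsum_wt_mul_blockAbar'_one_zero_le_letterHsup p hu

/-- **Row `a = 2`, `w = 0` of `R_R`** (Case b)): `Σ_ι R_R^{w=0}(ι,2) ≤ sup_{x≠0} H₂(x) · Σ_{u≠0} 𝓓_{2,2}(u)`.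
[cite: FitznerVanDerHofstad2017, App. C.1 Case b) (w = 0, u ≠ w), bound (C.3) (arXiv:1506.07977v2 p. 79)] -/
theorem sum_rawRPieceAt0_two_le :
    ∑ ι, rawRPieceAt0 (blockPSn (Letters.perc d p)) (blockAbar' (Letters.perc d p)) ι 2 ≤
      letterHsup (Letters.perc d p) 2 * ∑' u, kdc u 0 * (Letters.perc d p).D (.ge 2) (.ge 2) u :=
  sum_rawRPieceAt0_le_of_mid _ _ 2 _ _ (blockPSn_two_zero_right _)
    fun _ hu => sum_tsum_wt_mul_blockAbar'_two_zero_le_letterHsup p hu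

end Rows

end Literature.Probability.FitznerVanDerHofstad2017.NobleBlocks
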